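import Literature.NumberTheory.LocalFields.UnramifiedQuadraticNormSurjective
import Mathlib.RingTheory.Artinian.Module
import Mathlib.RingTheory.Artinian.Ring
import Mathlib.RingTheory.Ideal.Quotient.Operations
import HarnessLib

/-!
# Norms of a quadratic involution are surjective on fixed units over a complete SEMILOCAL ring with finite reduced residue ring
(Serre, *Local Fields*, Ch. V §2, Prop. 3 and its Corollary, Remark 1 — the unramified quadratic case; Kottwitz,
*Stable trace formula: elliptic singular terms* (1986), proof of Prop. 7.1 — the norm equation on the commutant order)

Topic `NumberTheory/LocalFields`, namespace `Literature.NumberTheory.LocalFields.UnramifiedQuadraticNorm` (new declaration names;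
companion of ★ `UnramifiedQuadraticNormSurjective`, whose §1 Hensel step `exists_mul_map_eq_of_sub_mem` is stated for ANY commutative
ring complete for an ideal `I` and whose §2–§4 then specialise to a LOCAL ring).  THEOREMS ONLY: no definition, no named fact, no
instance, no notation, no `sorry`.  Mathlib + the ★ companion only.

WHY (consumer: the unitary upgrade of Kottwitz's integral conjugacy lemma, floor-0 repayment of ★
`UnitaryGroup.UnramifiedOrbitSetAE` ∕ ★ `Rogawski1990.MatchingAdeleGEventuallyKConj` of the ENGINE line `F0_T1InnerFormTraceIdentity`).
For `γ ∈ U(J)(𝒪_w)` regular with characteristic polynomial separable modulo `𝔪_w`, an integral conjugator `k₀ ∈ GL_N(𝒪_w)` (★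
`IntegralConjugacyOfRegularElements`) is corrected to a UNITARY integral conjugator by solving `τ(c) c = τ(k₀) k₀` in the commutant
order `B = 𝒪_w[γ]`, a finite free `𝒪_w`-algebra with the involution `τ = Ad(J⁻¹) ∘ σ-transpose`: `B` is complete for `𝔪_w B` but is
NOT local — its residue ring `B ⧸ 𝔪_w B = k_w[x]⧸(χ̄_γ)` is a finite PRODUCT of finite fields permuted by `τ̄`.  This file supplies
exactly that case.

* §1 `exists_add_map_eq_one_of_isUnit_sub'` — over ANY commutative ring, an involution moving some element by a unit has a `t`
  with `t + σ t = 1` (the ★ companion's `HermitianFormsHensel.exists_add_map_eq_one_of_isUnit_sub` assumes a local ring; the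
  witness `t = -a (σ a - a)⁻¹` needs nothing).
* §2 `exists_mul_map_eq_of_finite_field` — a FINITE FIELD with an involution `τ ≠ id`: every `τ`-fixed element is a norm `y · τ y`
  (★ `exists_prod_smul_eq_of_forall_smul_eq` for the group `{1, τ}`; Serre's Remark 1).
* §3 **`exists_mul_map_eq_of_finite_of_isReduced`** — a FINITE REDUCED commutative ring `S` with an involution `τ` moving some element
  by a unit: every `τ`-fixed element is a norm `x · τ x`.  Proof: `S` is Artinian reduced, so `⋂ 𝔪 = 0` over its finitely many maximal
  ideals and the Chinese remainder theorem applies (Mathlib `Ideal.exists_forall_sub_mem_ideal`); `τ` permutes the maximal ideals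
  (`𝔪 ↦ τ⁻¹ 𝔪`); on a FIXED `𝔪` the induced involution of the finite field `S ⧸ 𝔪` is `≠ id` (it moves the residue of `a` by a unit)
  so §2 gives the residue; on a SWAPPED pair `{𝔪, τ 𝔪}` the residues `(u, 1)` work because `τ u = u` (an injection of the maximal
  spectrum into `ℕ` decides which member of the pair carries `u`).
* §4 **`exists_mul_map_eq_of_isReduced_quotient`** — `R` complete and separated for `I` with `σ(I) ⊆ I`, `R ⧸ I` finite and reduced,
  `σ a − a ∈ Rˣ` for some `a`: every `σ`-fixed UNIT is a norm `s · σ s` (§3 modulo `I`, then the ★ Hensel step).  For `R` local this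
  is ★ `exists_mul_map_eq_of_finite_residueField`.

## References
* [Serre1979] J.-P. Serre, *Local Fields*, GTM 67 (1979), Ch. V §2 Prop. 3, Corollary and Remark 1.
* [Kottwitz1986] R. E. Kottwitz, *Stable trace formula: elliptic singular terms*, Math. Ann. 275 (1986), §7, proof of Prop. 7.1.
-/

set_option autoImplicit false

namespace Literature.NumberTheory.LocalFields.UnramifiedQuadraticNorm

/-! ## §1 The trace of an involution moving an element by a unit hits `1` (any commutative ring) -/

section Trace

variable {R : Type*} [CommRing R] (σ : R →+* R)

/-- **The trace hits `1`**: for an involution `σ` of a commutative ring with `σ a − a` a unit for some `a`, there is `t` with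
`t + σ t = 1`, namely `t = -a · (σ a - a)⁻¹` (since `σ (σ a - a) = -(σ a - a)`).  No locality is needed (compare ★
`HermitianFormsHensel.exists_add_map_eq_one_of_isUnit_sub`). [cite: Serre1979, Ch. V §2, proof of Prop. 3] -/
theorem exists_add_map_eq_one_of_isUnit_sub' (hσ : ∀ a, σ (σ a) = a) {a : R} (ha : IsUnit (σ a - a)) :
    ∃ t : R, t + σ t = 1 := by
  obtain ⟨d, hd⟩ := ha
  have hσd : σ (d : R) = -(d : R) := by rw [hd, map_sub, hσ, neg_sub]
  have hσdi : σ (↑d⁻¹ : R) = -(↑d⁻¹ : R) := by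
    have h1 : σ (↑d⁻¹ : R) * σ (d : R) = 1 := by rw [← map_mul, Units.inv_mul, map_one]
    rw [hσd, mul_neg, neg_eq_iff_eq_neg] at h1
    calc σ (↑d⁻¹ : R) = σ (↑d⁻¹ : R) * ((d : R) * ↑d⁻¹) := by rw [Units.mul_inv, mul_one]
      _ = (σ (↑d⁻¹ : R) * (d : R)) * ↑d⁻¹ := by rw [mul_assoc]
      _ = -(↑d⁻¹ : R) := by rw [h1, neg_one_mul]
  refine ⟨-a * ↑d⁻¹, ?_⟩
  rw [map_mul, map_neg, hσdi]
  calc -a * (↑d⁻¹ : R) + -σ a * -(↑d⁻¹ : R) = (σ a - a) * ↑d⁻¹ := by ring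
    _ = 1 := by rw [← hd, Units.mul_inv]

end Trace

/-! ## §2 Finite fields: every element fixed by an involution `τ ≠ id` is a norm `y · τ y` -/

section FiniteField

/-- **The norm of the quadratic extension `k ⊃ k^τ` of FINITE fields is onto** (Serre's Remark 1 «Condition (3) is satisfied when
`K̄` is a finite field»): for a finite field `k` with a ring involution `τ ≠ id`, every `τ`-fixed `v` is `y · τ y` for some `y`
(the group `{1, τ}` of order `2` acts faithfully; ★ `exists_prod_smul_eq_of_forall_smul_eq`). [cite: Serre1979, Ch. V §2, Corollary to Prop. 3 and Remark 1] -/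
theorem exists_mul_map_eq_of_finite_field {k : Type*} [Field k] [Finite k] (τ : k →+* k) (hτ : ∀ a, τ (τ a) = a)
    {a : k} (ha : τ a ≠ a) (v : k) (hv : τ v = v) : ∃ y : k, y * τ y = v := by
  classical
  have hττ : τ.comp τ = RingHom.id k := RingHom.ext fun x => by rw [RingHom.comp_apply, hτ, RingHom.id_apply]
  set θ : RingAut k := RingEquiv.ofRingHom τ τ hττ hττ with hθ_def
  have hθ : ∀ x : k, θ x = τ x := fun x => rfl
  have hθ2 : θ ^ 2 = 1 := by
    refine RingEquiv.ext fun x => ?_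
    rw [pow_two, RingAut.mul_apply, hθ, hθ, hτ, RingAut.one_apply]
  have hθ1 : θ ≠ 1 := by
    intro h1
    have h := congrArg (fun e : RingAut k => e a) h1
    simp only [hθ, RingAut.one_apply] at h
    exact ha h
  have hθfin : IsOfFinOrder θ := isOfFinOrder_iff_pow_eq_one.2 ⟨2, two_pos, hθ2⟩
  have hθord : orderOf θ = 2 := orderOf_eq_prime hθ2 hθ1
  haveI : Fintype (Subgroup.zpowers θ) := Fintype.ofEquiv _ (finEquivZPowers hθfin)
  have hfix : ∀ g : Subgroup.zpowers θ, g • v = v := by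
    have hle : Subgroup.zpowers θ ≤ MulAction.stabilizer (RingAut k) v := by
      rw [Subgroup.zpowers_le, MulAction.mem_stabilizer_iff, RingAut.smul_def, hθ, hv]
    intro g
    have hg := hle g.2
    rw [MulAction.mem_stabilizer_iff] at hg
    rw [Subgroup.smul_def]
    exact hg
  obtain ⟨x, hx⟩ := exists_prod_smul_eq_of_forall_smul_eq (G := Subgroup.zpowers θ) v hfix
  have hprod : ∏ g : Subgroup.zpowers θ, g • x = x * τ x := by
    rw [← Fintype.prod_equiv (finEquivZPowers hθfin) (fun i => (θ ^ (i : ℕ)) • x) (fun g => g • x)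
      (fun i => by rw [finEquivZPowers_apply]; rfl)]
    rw [Fin.prod_univ_eq_prod_range (fun i => (θ ^ i) • x) (orderOf θ), hθord, Finset.prod_range_succ,
      Finset.prod_range_succ, Finset.prod_range_zero, one_mul, pow_zero, pow_one, one_smul, RingAut.smul_def, hθ]
  exact ⟨x, by rw [← hprod, hx]⟩

end FiniteField

/-! ## §3 Finite reduced rings: every element fixed by an involution moving a unit is a norm -/

section FiniteReduced

variable {S : Type*} [CommRing S] (τ : S →+* S)

/-- An involutive ring endomorphism is surjective. [folklore] -/
private theorem surjective_of_involutive (hτ : ∀ a, τ (τ a) = a) : Function.Surjective τ := fun a => ⟨τ a, hτ a⟩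

/-- **Norm surjectivity for a quadratic involution of a FINITE REDUCED ring** (the residue ring `k_w[x]⧸(χ̄)` of the commutant order
in Kottwitz's unitary lemma): `S` finite, reduced, commutative, `τ` a ring involution of `S` with `τ a − a ∈ Sˣ` for some `a`; then
every `τ`-fixed `u ∈ S` is a norm, `u = x · τ x`.  (`S ≅ ∏_𝔪 S⧸𝔪` over its finitely many maximal ideals, permuted by `τ`; on a fixed
`𝔪` the induced involution of the finite field `S⧸𝔪` is non-trivial and §2 applies, a swapped pair `{𝔪, τ𝔪}` takes the residues
`(u, 1)`; glue by the Chinese remainder theorem, conclude by `⋂ 𝔪 = nilradical = 0`.) [cite: Serre1979, Ch. V §2, Corollary to Prop. 3 and Remark 1]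
[cite: Kottwitz1986, §7, proof of Prop. 7.1] -/
theorem exists_mul_map_eq_of_finite_of_isReduced [Finite S] [IsReduced S] (hτ : ∀ a, τ (τ a) = a) {a : S}
    (ha : IsUnit (τ a - a)) (u : S) (hτu : τ u = u) : ∃ x : S, x * τ x = u := by
  classical
  haveI : IsArtinianRing S := isArtinian_of_finite
  -- `τ` acts on the maximal spectrum by `𝔪 ↦ τ⁻¹ 𝔪 = comap τ 𝔪`, an involution
  let ι : MaximalSpectrum S → MaximalSpectrum S := fun 𝔪 =>
    ⟨𝔪.asIdeal.comap τ, Ideal.comap_isMaximal_of_surjective τ (surjective_of_involutive τ hτ)⟩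
  have hιmem : ∀ (𝔪 : MaximalSpectrum S) (x : S), x ∈ (ι 𝔪).asIdeal ↔ τ x ∈ 𝔪.asIdeal := fun _ _ => Iff.rfl
  have hιι : ∀ 𝔪, ι (ι 𝔪) = 𝔪 := by
    intro 𝔪
    apply MaximalSpectrum.ext
    ext x
    change τ (τ x) ∈ 𝔪.asIdeal ↔ x ∈ 𝔪.asIdeal
    rw [hτ]
  -- FIXED maximal ideals: the residue from §2
  have hfix : ∀ 𝔪 : MaximalSpectrum S, ι 𝔪 = 𝔪 → ∃ y : S, y * τ y - u ∈ 𝔪.asIdeal := by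
    intro 𝔪 h𝔪
    haveI : 𝔪.asIdeal.IsMaximal := 𝔪.isMaximal
    have hle : 𝔪.asIdeal ≤ 𝔪.asIdeal.comap τ := by
      intro x hx
      have hx' : x ∈ (ι 𝔪).asIdeal := by rw [h𝔪]; exact hx
      exact hx'
    let τb : S ⧸ 𝔪.asIdeal →+* S ⧸ 𝔪.asIdeal := Ideal.quotientMap 𝔪.asIdeal τ hle
    have hτb : ∀ x : S, τb (Ideal.Quotient.mk 𝔪.asIdeal x) = Ideal.Quotient.mk 𝔪.asIdeal (τ x) := fun x =>
      Ideal.quotientMap_mk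
    have hτbτb : ∀ z, τb (τb z) = z := by
      intro z
      obtain ⟨x, rfl⟩ := Ideal.Quotient.mk_surjective z
      rw [hτb, hτb, hτ]
    haveI : Finite (S ⧸ 𝔪.asIdeal) := Finite.of_surjective _ Ideal.Quotient.mk_surjective
    letI : Field (S ⧸ 𝔪.asIdeal) := Ideal.Quotient.field 𝔪.asIdeal
    have hab : τb (Ideal.Quotient.mk 𝔪.asIdeal a) ≠ Ideal.Quotient.mk 𝔪.asIdeal a := by
      intro h
      have hunit : IsUnit (Ideal.Quotient.mk 𝔪.asIdeal (τ a - a)) := ha.map _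
      rw [map_sub, ← hτb, h, sub_self] at hunit
      exact not_isUnit_zero hunit
    obtain ⟨yb, hyb⟩ := exists_mul_map_eq_of_finite_field τb hτbτb hab (Ideal.Quotient.mk 𝔪.asIdeal u)
      (by rw [hτb, hτu])
    obtain ⟨y, rfl⟩ := Ideal.Quotient.mk_surjective yb
    refine ⟨y, ?_⟩
    rw [← Ideal.Quotient.eq, map_mul, ← hτb]
    exact hyb
  choose! yfix hyfix using hfix
  -- an injection of the (finite) maximal spectrum into `ℕ` decides which member of a swapped pair carries `u`
  obtain ⟨enc, henc⟩ := Countable.exists_injective_nat (MaximalSpectrum S)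
  let s : MaximalSpectrum S → S := fun 𝔪 => if ι 𝔪 = 𝔪 then yfix 𝔪 else if enc 𝔪 < enc (ι 𝔪) then u else 1
  -- the residues multiply correctly: `s 𝔪 · τ (s (τ⁻¹ 𝔪)) ≡ u (mod 𝔪)`
  have hs : ∀ 𝔪 : MaximalSpectrum S, s 𝔪 * τ (s (ι 𝔪)) - u ∈ 𝔪.asIdeal := by
    intro 𝔪
    by_cases hf : ι 𝔪 = 𝔪
    · have h1 : s 𝔪 = yfix 𝔪 := by simp only [s, if_pos hf]
      rw [hf, h1]
      exact hyfix 𝔪 hf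
    · have hf' : ι (ι 𝔪) ≠ ι 𝔪 := by rw [hιι]; exact Ne.symm hf
      have hne : enc 𝔪 ≠ enc (ι 𝔪) := fun h => hf (henc h).symm
      have h1 : s 𝔪 = if enc 𝔪 < enc (ι 𝔪) then u else 1 := by simp only [s, if_neg hf]
      have h2 : s (ι 𝔪) = if enc (ι 𝔪) < enc 𝔪 then u else 1 := by simp only [s, if_neg hf', hιι]
      rcases lt_or_gt_of_ne hne with hlt | hgt
      · rw [h1, h2, if_pos hlt, if_neg (not_lt.2 hlt.le), map_one, mul_one, sub_self]
        exact zero_mem _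
      · rw [h1, h2, if_neg (not_lt.2 hgt.le), if_pos hgt, one_mul, hτu, sub_self]
        exact zero_mem _
  -- Chinese remainder theorem: `x ≡ s 𝔪 (mod 𝔪)` for every maximal `𝔪`
  have hcop : Pairwise (Function.onFun IsCoprime fun 𝔪 : MaximalSpectrum S => 𝔪.asIdeal) := by
    intro 𝔪 𝔪' hne
    exact Ideal.isCoprime_iff_sup_eq.2 (𝔪.isMaximal.coprime_of_ne 𝔪'.isMaximal fun h => hne (MaximalSpectrum.ext h))
  obtain ⟨x, hx⟩ := Ideal.exists_forall_sub_mem_ideal hcop s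
  refine ⟨x, ?_⟩
  -- `x · τ x - u` lies in every maximal ideal
  have hall : ∀ 𝔪 : MaximalSpectrum S, x * τ x - u ∈ 𝔪.asIdeal := by
    intro 𝔪
    have h1 : x - s 𝔪 ∈ 𝔪.asIdeal := hx 𝔪
    have h2 : τ x - τ (s (ι 𝔪)) ∈ 𝔪.asIdeal := by
      rw [← map_sub, ← hιmem]
      exact hx (ι 𝔪)
    have h3 : x * τ x - u = (x - s 𝔪) * τ x + s 𝔪 * (τ x - τ (s (ι 𝔪))) + (s 𝔪 * τ (s (ι 𝔪)) - u) := by ring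
    rw [h3]
    exact add_mem (add_mem (Ideal.mul_mem_right _ _ h1) (Ideal.mul_mem_left _ _ h2)) (hs 𝔪)
  -- hence in the Jacobson radical, which is nilpotent (Artinian), hence zero (reduced)
  have hJ : x * τ x - u ∈ Ideal.jacobson (⊥ : Ideal S) := by
    rw [Ideal.jacobson, Ideal.mem_sInf]
    rintro J ⟨-, hJ⟩
    exact hall ⟨J, hJ⟩
  obtain ⟨n, hn⟩ := IsArtinianRing.isNilpotent_jacobson_bot (R := S)
  have hnil : IsNilpotent (x * τ x - u) := by
    refine ⟨n, ?_⟩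
    have h := Ideal.pow_mem_pow hJ n
    rw [hn] at h
    exact (Submodule.mem_bot S).1 h
  exact sub_eq_zero.1 hnil.eq_zero

end FiniteReduced

/-! ## §4 Complete semilocal rings with finite reduced residue ring: fixed units are norms -/

section Complete

variable {R : Type*} [CommRing R] (σ : R →+* R) {I : Ideal R} [IsAdicComplete I R]

/-- **Serre V §2 Corollary + Remark 1 for a complete SEMILOCAL ring** (the commutant order `𝒪_w[γ]` of Kottwitz's unitary lemma): `R`
complete and separated for an ideal `I` with `σ(I) ⊆ I`, `R ⧸ I` FINITE and REDUCED (a finite product of finite fields), `σ` an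
involution with `σ a − a ∈ Rˣ` for some `a`; then every `σ`-fixed unit `u` is a norm, `u = s · σ s` — §3 modulo `I`, then the Hensel
step ★ `exists_mul_map_eq_of_sub_mem` with the trace of §1. [cite: Serre1979, Ch. V §2 Prop. 3, Corollary and Remark 1]
[cite: Kottwitz1986, §7, proof of Prop. 7.1] -/
theorem exists_mul_map_eq_of_isReduced_quotient (hσ : ∀ a, σ (σ a) = a) (hσI : ∀ a ∈ I, σ a ∈ I) [Finite (R ⧸ I)]
    [IsReduced (R ⧸ I)] {a : R} (ha : IsUnit (σ a - a)) (u : R) (hu : IsUnit u) (hσu : σ u = u) :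
    ∃ s : R, s * σ s = u := by
  obtain ⟨t, ht⟩ := exists_add_map_eq_one_of_isUnit_sub' σ hσ ha
  have hle : I ≤ I.comap σ := fun x hx => hσI x hx
  let τ : R ⧸ I →+* R ⧸ I := Ideal.quotientMap I σ hle
  have hτmk : ∀ x : R, τ (Ideal.Quotient.mk I x) = Ideal.Quotient.mk I (σ x) := fun x => Ideal.quotientMap_mk
  have hττ : ∀ z, τ (τ z) = z := by
    intro z
    obtain ⟨x, rfl⟩ := Ideal.Quotient.mk_surjective z
    rw [hτmk, hτmk, hσ]
  have hab : IsUnit (τ (Ideal.Quotient.mk I a) - Ideal.Quotient.mk I a) := by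
    rw [hτmk, ← map_sub]
    exact ha.map _
  obtain ⟨z, hz⟩ := exists_mul_map_eq_of_finite_of_isReduced τ hττ hab (Ideal.Quotient.mk I u) (by rw [hτmk, hσu])
  obtain ⟨s₀, rfl⟩ := Ideal.Quotient.mk_surjective z
  have hs₀ : u - s₀ * σ s₀ ∈ I := by
    rw [← Ideal.Quotient.eq, map_mul, ← hτmk]
    exact hz.symm
  obtain ⟨s, hs, -⟩ := exists_mul_map_eq_of_sub_mem σ hσ hσI ht hu hσu hs₀
  exact ⟨s, hs⟩

end Complete

end Literature.NumberTheory.LocalFields.UnramifiedQuadraticNorm
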